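import Mathlib
import HarnessLib
import Summits.AtomisticToContinuum.FouriersLaw.Theses.StaticAbelianSqueeze

/-!
# Birth skeleton (BC3) for crux `StaticAbelianSqueeze.LiouvilleNoGap`
(item `stmt-AtomisticToContinuum-13418`, route `route-AtomisticToContinuum-StaticAbelianSqueeze`, crux rank 4;
sub-problem `FouriersLaw`; registrar `planner-skel-stmt-AtomisticToContinuum-13418-0`, 2026-08-17)

Crux (FIXED, concluded BY NAME below).  For `P = pinnedChain ω₂ lam β γ` (all `> 0`), `T > 0`, every
shift-invariant DLR Gibbs state `μ_T` of the infinite chain and every `ν > 0`, with the STATIC vocabulary of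
the route — translation-summed covariance bracket `⟨⟨f₁,f₂⟩⟩ := Σ_{x∈ℤ} Cov_{μ_T}(f₁, f₂∘τ_x)` (the `br` of
the item), `j := bondCurrentZ · 0`, `𝒜 := liouvilleZ P` (infinite-chain Liouvillian),
`PRIMAL_ν(g) := 2⟨⟨j,g⟩⟩ − ν⟨⟨g,g⟩⟩ − ν⁻¹⟨⟨𝒜g,𝒜g⟩⟩`, `DUAL_ν(u) := ν⁻¹⟨⟨j+𝒜u,j+𝒜u⟩⟩ + ν⟨⟨u,u⟩⟩` —
for every `ε > 0` there are LOCAL test functions `g, u` (`IsLocalTestFunction`) with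
`DUAL_ν(u) ≤ PRIMAL_ν(g) + ε`: NO DUALITY GAP between the static primal and dual `ν`-problems over local
functions (Bernardin–Olla 2011 §6 variational formulae; printed there as an ASSUMPTION for unbounded `V″`).

## Line `birth` — LAGRANGE IDENTITY × APPROXIMATE SADDLE SYSTEM (gap = squared KKT residuals)

Write `r₁(g,u) := j + 𝒜u − νg` and `r₂(g,u) := νu − 𝒜g` — the residuals of the pair `(g,u)` in the
Euler–Lagrange (saddle-point / KKT) system of the primal–dual pair, `νg − 𝒜u = j`, `𝒜g − νu = 0`
(equivalently, with `v := g+u`, `w := g−u`: the FORWARD and BACKWARD resolvent equations `(ν − 𝒜)v = j`,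
`(ν + 𝒜)w = j`; `‖r₁‖² + ‖r₂‖² = ½(‖(ν−𝒜)v − j‖² + ‖(ν+𝒜)w − j‖²)`).

* `stub_gapIdentity` (LAGRANGE / COMPLETED-SQUARE IDENTITY in `ℋ₀(μ_T)`): for ALL local test functions
  `g, u`:  `DUAL_ν(u) − PRIMAL_ν(g) = ν⁻¹⟨⟨r₁,r₁⟩⟩ + ν⁻¹⟨⟨r₂,r₂⟩⟩`.
  Content: (a) the summed bracket is FINITE and BILINEAR on the span of `j`, local test functions and their
  `𝒜`-images (all polynomial moments of the one-site marginal of a DLR state of `P` + summable decay of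
  correlations of the shift-invariant 1-D Gibbs state: transfer operator `e^{−U/2T}e^{−V(q′−q)/T}e^{−U/2T}`,
  Hilbert–Schmidt with simple top eigenvalue), (b) SYMMETRY `⟨⟨f,h⟩⟩ = ⟨⟨h,f⟩⟩` (shift-invariance, `x ↦ −x`),
  (c) SKEW-SYMMETRY `⟨⟨𝒜f,h⟩⟩ = −⟨⟨f,𝒜h⟩⟩` (infinitesimal stationarity `∫ 𝒜F dμ_T = 0` of the DLR state
  under the Hamiltonian vector field — integration by parts inside a finite box against the Gibbs
  specification — plus the Leibniz rule and `𝒜 ∘ τ_x = τ_x ∘ 𝒜`); then the identity is the algebra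
  `ν⁻¹‖r₁‖² + ν⁻¹‖r₂‖² = DUAL − PRIMAL + 2(⟨⟨𝒜u,g⟩⟩ + ⟨⟨u,𝒜g⟩⟩)` with the last bracket `= 0`
  (the abstract algebra is the refuter's sorry-free `dual_sub_primal_eq`, evidence WeakDuality.lean on the
  item, 2026-08-15; this stub is its instantiation to the concrete `tsum`/Bochner bracket, i.e. the
  finiteness/stationarity facts (a)–(c)).  Size M–L.  In particular it yields WEAK DUALITY
  `PRIMAL_ν ≤ DUAL_ν`, so the crux is exactly `sup PRIMAL_ν = inf DUAL_ν`.
* `stub_saddleResidual` (APPROXIMATE LOCAL SOLVABILITY OF THE SADDLE SYSTEM = `(j,0)` lies in the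
  `ℋ₀ ⊕ ℋ₀`-closure of the range of `ν − K`, `K := [[0,𝒜],[𝒜,0]]`, on local pairs): for every `ε > 0` there
  are local test functions `g, u` with `⟨⟨r₁,r₁⟩⟩ + ⟨⟨r₂,r₂⟩⟩ ≤ ε`.  This is the LINEAR form of the no-gap
  statement: it holds iff `j ⊥ ker(ν ∓ 𝒜*)` in `ℋ₀`, and it follows from essential skew-adjointness of `𝒜` on
  local functions in `ℋ₀(μ_T)` (the translation-summed analogue of Marchioro–Pellegrinotti–Pulvirenti 1978,
  who prove the `L²(μ)` core property from the μ-a.e. infinite-volume dynamics of Lanford–Lebowitz–Lieb 1977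
  and its invariance); engines: LLL Thm 3 dynamics + unitary group on `ℋ₀` (needs covariance-summed
  locality of the quartic-coupling dynamics, Buttà–Caglioti–Di Ruzza–Marchioro 2007 give it for harmonic
  coupling only), or a direct finite-volume (ring) resolvent approximation with boundary terms `o(L)`.
  Exactly solvable check: at `lam = β = 0` the current `𝒜j` is an exact lattice gradient, `𝒜j = 0` in `ℋ₀`,
  and `g = j/ν`, `u = 0` give `r₁ = r₂ = 0` (refuter's `harmonic_grad`).  Size L (the crux's difficulty
  lives here, in linear form).
* COMPOSITION (sorry-free, real proof) `liouvilleNoGap_of_gapIdentity_of_saddleResidual :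
  stub₁-statement → stub₂-statement → (the crux's definiens VERBATIM)`: given `ν, ε > 0` take `g, u` from
  `stub_saddleResidual` at tolerance `ν·ε`; by `stub_gapIdentity`, `DUAL_ν(u) − PRIMAL_ν(g) = ν⁻¹(⟨⟨r₁,r₁⟩⟩ +
  ⟨⟨r₂,r₂⟩⟩) ≤ ν⁻¹·ν·ε = ε` (one abstract real-variable lemma; the chain expressions meet only by
  unification).  At the crux's NAME: `LiouvilleNoGap_of : StaticAbelianSqueeze.LiouvilleNoGap :=
  liouvilleNoGap_of_gapIdentity_of_saddleResidual stub_gapIdentity stub_saddleResidual` — the only theorem of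
  this file concluding the crux; its `sorry`s are exactly the two stubs.
* SIGNATURE CONVENTION: both stubs are `let`-free — the crux's `let br := …; let jZ := …` become arguments
  `∀ br, br = (fun f₁ f₂ => …) → ∀ jZ, jZ = (fun σ => …) → …`, instantiated by `rfl` in the seam (the
  registered stub signatures must not contain `:=`; provers prove them exactly as registered).

Hardest stub: `stub_saddleResidual` (core / no-deficiency property of the infinite anharmonic Liouvillian in
the summed bracket — in print only as an assumption, BernardinOlla2011 p. 11; MPP 1978 is `L²(μ)` and
superstable, not `ℋ₀`).  Why the cut is not a costume: `stub_gapIdentity` is an IDENTITY valid for every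
pair (it asserts nothing about near-optimisers and is consistent with a positive gap — a deficiency vector
of `𝒜` makes both sides strictly positive uniformly); `stub_saddleResidual` bounds RESIDUAL NORMS of a linear
system and says nothing about `PRIMAL`/`DUAL` without the bracket calculus of `stub_gapIdentity` (finiteness,
symmetry, skew-symmetry of the concrete `tsum`-of-covariances bracket, none of which is available by
unfolding); neither stub mentions `FouriersLaw`.  BC3 probes `stub → LiouvilleNoGap` and `stub → FouriersLaw`
by `first | exact? | simpa [S] | (unfold S; simpa) | aesop` FAIL for both stubs (planner folder `bc/`,
quoted in NOTES.md / `Lines/birth.md`).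
Disproof used: none on file (`ledger crux ls stmt-AtomisticToContinuum-13418`: no workfiles — no
`Disproof.lean`, no `Negative/` lemma, no prior `Lines/` — 2026-08-17).  Refuter evidence respected:
WeakDuality.lean (rattack-13418, 2026-08-15: weak duality automatic for a symmetric PSD bracket with skew `𝒜`;
harmonic case gap-free; anharmonic remainder of `𝒜j` non-gradient, so the item has content) — the line is
built on exactly that identity, and both stubs keep the full Gibbs / shift-invariance prefix of the crux.
-/

noncomputable section

open MeasureTheory
open scoped BigOperators Topology

namespace Summit.AtomisticToContinuum.FouriersLaw.Cruxes.LiouvilleNoGap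

namespace Birth

/-! ## The two registered stubs -/

/-- **stub 1 — `stub_gapIdentity` (Lagrange identity: duality gap = `ν⁻¹` × squared saddle residuals).**
For `pinnedChain ω₂ lam β γ` (all `> 0`), `T > 0`, every shift-invariant DLR Gibbs state `μT`, every `ν > 0`
and ALL local test functions `g, u`:
`DUAL_ν(u) − PRIMAL_ν(g) = ν⁻¹⟨⟨j+𝒜u−νg, j+𝒜u−νg⟩⟩ + ν⁻¹⟨⟨νu−𝒜g, νu−𝒜g⟩⟩`
in the translation-summed covariance bracket of `μT` (finiteness + bilinearity + symmetry of the bracket on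
the relevant class, and skew-symmetry of `liouvilleZ` in it, are the content).  The bracket `br` and the
current `jZ` of the crux's `let`s enter as ARGUMENTS with their defining equations (`br = …`, `jZ = …`), so
that the registered signature is `let`-free; instantiate with `rfl`. -/
theorem stub_gapIdentity :
    ∀ ω₂ lam β γ : ℝ, 0 < ω₂ → 0 < lam → 0 < β → 0 < γ → ∀ T : ℝ, 0 < T → ∀ μT : MeasureTheory.Measure Literature.MathematicalPhysics.KineticTheory.HeatConduction.ChainConfig, (Literature.MathematicalPhysics.KineticTheory.HeatConduction.pinnedChain ω₂ lam β γ).IsChainGibbsMeasure T μT → Literature.MathematicalPhysics.KineticTheory.HeatConduction.IsShiftInvariant μT → ∀ br : (Literature.MathematicalPhysics.KineticTheory.HeatConduction.ChainConfig → ℝ) → (Literature.MathematicalPhysics.KineticTheory.HeatConduction.ChainConfig → ℝ) → ℝ, br = (fun f₁ f₂ => ∑' x : ℤ, ((∫ σ, f₁ σ * f₂ (fun i => σ (i + x)) ∂μT) - (∫ σ, f₁ σ ∂μT) * (∫ σ, f₂ σ ∂μT))) → ∀ jZ : Literature.MathematicalPhysics.KineticTheory.HeatConduction.ChainConfig → ℝ,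 jZ = (fun σ => (Literature.MathematicalPhysics.KineticTheory.HeatConduction.pinnedChain ω₂ lam β γ).bondCurrentZ σ 0) → ∀ ν : ℝ, 0 < ν → ∀ g u : Literature.MathematicalPhysics.KineticTheory.HeatConduction.ChainConfig → ℝ, Literature.MathematicalPhysics.KineticTheory.HeatConduction.IsLocalTestFunction g → Literature.MathematicalPhysics.KineticTheory.HeatConduction.IsLocalTestFunction u → (ν⁻¹ * br (jZ + Literature.MathematicalPhysics.KineticTheory.HeatConduction.liouvilleZ (Literature.MathematicalPhysics.KineticTheory.HeatConduction.pinnedChain ω₂ lam β γ) u) (jZ + Literature.MathematicalPhysics.KineticTheory.HeatConduction.liouvilleZ (Literature.MathematicalPhysics.KineticTheory.HeatConduction.pinnedChain ω₂ lam β γ) u) + ν * br u u) - (2 * br jZ g - ν * br g g - ν⁻¹ * br (Literature.MathematicalPhysics.KineticTheory.HeatConduction.liouvilleZ (Literature.MathematicalPhysics.KineticTheory.HeatConduction.pinnedChain ω₂ lam β γ) g) (Literature.MathematicalPhysics.KineticTheory.HeatConduction.liouvilleZ (Literature.MathematicalPhysics.KineticTheory.HeatConduction.pinnedChain ω₂ lam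 β γ) g)) = ν⁻¹ * br (fun σ => jZ σ + Literature.MathematicalPhysics.KineticTheory.HeatConduction.liouvilleZ (Literature.MathematicalPhysics.KineticTheory.HeatConduction.pinnedChain ω₂ lam β γ) u σ - ν * g σ) (fun σ => jZ σ + Literature.MathematicalPhysics.KineticTheory.HeatConduction.liouvilleZ (Literature.MathematicalPhysics.KineticTheory.HeatConduction.pinnedChain ω₂ lam β γ) u σ - ν * g σ) + ν⁻¹ * br (fun σ => ν * u σ - Literature.MathematicalPhysics.KineticTheory.HeatConduction.liouvilleZ (Literature.MathematicalPhysics.KineticTheory.HeatConduction.pinnedChain ω₂ lam β γ) g σ) (fun σ => ν * u σ - Literature.MathematicalPhysics.KineticTheory.HeatConduction.liouvilleZ (Literature.MathematicalPhysics.KineticTheory.HeatConduction.pinnedChain ω₂ lam β γ) g σ) := by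
  sorry

/-- **stub 2 — `stub_saddleResidual` (the saddle / KKT system `νg − 𝒜u = j`, `𝒜g − νu = 0` is solvable by
LOCAL test functions up to `ε` in the summed bracket).**  For `pinnedChain ω₂ lam β γ` (all `> 0`), `T > 0`,
every shift-invariant DLR Gibbs state `μT`, every `ν > 0` and every `ε > 0` there are local test functions
`g, u` with `⟨⟨j+𝒜u−νg, j+𝒜u−νg⟩⟩ + ⟨⟨νu−𝒜g, νu−𝒜g⟩⟩ ≤ ε` — `(j,0)` is in the closed range of
`ν − [[0,𝒜],[𝒜,0]]` over local pairs (no deficiency of the local Liouvillian pair at spectral parameter `ν`;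
forward/backward resolvent approximants `v = g+u`, `w = g−u`).  Same `br = …`, `jZ = …` argument convention
as `stub_gapIdentity`. -/
theorem stub_saddleResidual :
    ∀ ω₂ lam β γ : ℝ, 0 < ω₂ → 0 < lam → 0 < β → 0 < γ → ∀ T : ℝ, 0 < T → ∀ μT : MeasureTheory.Measure Literature.MathematicalPhysics.KineticTheory.HeatConduction.ChainConfig, (Literature.MathematicalPhysics.KineticTheory.HeatConduction.pinnedChain ω₂ lam β γ).IsChainGibbsMeasure T μT → Literature.MathematicalPhysics.KineticTheory.HeatConduction.IsShiftInvariant μT → ∀ br : (Literature.MathematicalPhysics.KineticTheory.HeatConduction.ChainConfig → ℝ) → (Literature.MathematicalPhysics.KineticTheory.HeatConduction.ChainConfig → ℝ) → ℝ, br = (fun f₁ f₂ => ∑' x : ℤ, ((∫ σ, f₁ σ * f₂ (fun i => σ (i + x)) ∂μT) - (∫ σ, f₁ σ ∂μT) * (∫ σ, f₂ σ ∂μT))) → ∀ jZ : Literature.MathematicalPhysics.KineticTheory.HeatConduction.ChainConfig → ℝ, jZ = (fun σ => (Literature.MathematicalPhysics.KineticTheory.HeatConduction.pinnedChain ω₂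 lam β γ).bondCurrentZ σ 0) → ∀ ν : ℝ, 0 < ν → ∀ ε : ℝ, 0 < ε → ∃ g u : Literature.MathematicalPhysics.KineticTheory.HeatConduction.ChainConfig → ℝ, Literature.MathematicalPhysics.KineticTheory.HeatConduction.IsLocalTestFunction g ∧ Literature.MathematicalPhysics.KineticTheory.HeatConduction.IsLocalTestFunction u ∧ br (fun σ => jZ σ + Literature.MathematicalPhysics.KineticTheory.HeatConduction.liouvilleZ (Literature.MathematicalPhysics.KineticTheory.HeatConduction.pinnedChain ω₂ lam β γ) u σ - ν * g σ) (fun σ => jZ σ + Literature.MathematicalPhysics.KineticTheory.HeatConduction.liouvilleZ (Literature.MathematicalPhysics.KineticTheory.HeatConduction.pinnedChain ω₂ lam β γ) u σ - ν * g σ) + br (fun σ => ν * u σ - Literature.MathematicalPhysics.KineticTheory.HeatConduction.liouvilleZ (Literature.MathematicalPhysics.KineticTheory.HeatConduction.pinnedChain ω₂ lam β γ) g σ) (fun σ => ν * u σ - Literature.MathematicalPhysics.KineticTheory.HeatConduction.liouvilleZ (Literature.MathematicalPhysics.KineticTheory.HeatConduction.pinnedChain ω₂ lam β γ) g σ) ≤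 ε := by
  sorry

/-! ## The composition (sorry-free) -/

/-- One abstract real-variable lemma: an exact gap formula `D − P = ν⁻¹A + ν⁻¹B` and a residual bound
`A + B ≤ ν ε` give `D ≤ P + ε`. -/
theorem gap_le_of_identity_of_residual (ν ε D P A B : ℝ) (hν : 0 < ν)
    (hid : D - P = ν⁻¹ * A + ν⁻¹ * B) (hres : A + B ≤ ν * ε) : D ≤ P + ε := by
  have h1 : ν⁻¹ * (A + B) ≤ ν⁻¹ * (ν * ε) :=
    mul_le_mul_of_nonneg_left hres (inv_nonneg.mpr hν.le)
  rw [← mul_assoc, inv_mul_cancel₀ hν.ne', one_mul, mul_add] at h1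
  linarith

/-- **The implication, sorry-free**: `stub_gapIdentity`-statement → `stub_saddleResidual`-statement → the
statement of `StaticAbelianSqueeze.LiouvilleNoGap` (conclusion = the crux's definiens VERBATIM, so that
`LiouvilleNoGap_of` below is this term at the crux's name).  Given `ν, ε > 0`: residual pair at tolerance
`ν·ε`, then the identity and `gap_le_of_identity_of_residual`. -/
theorem liouvilleNoGap_of_gapIdentity_of_saddleResidual :
    (∀ ω₂ lam β γ : ℝ, 0 < ω₂ → 0 < lam → 0 < β → 0 < γ → ∀ T : ℝ, 0 < T → ∀ μT : MeasureTheory.Measure Literature.MathematicalPhysics.KineticTheory.HeatConduction.ChainConfig, (Literature.MathematicalPhysics.KineticTheory.HeatConduction.pinnedChain ω₂ lam β γ).IsChainGibbsMeasure T μT → Literature.MathematicalPhysics.KineticTheory.HeatConduction.IsShiftInvariant μT → ∀ br : (Literature.MathematicalPhysics.KineticTheory.HeatConduction.ChainConfig → ℝ) → (Literature.MathematicalPhysics.KineticTheory.HeatConduction.ChainConfig → ℝ) → ℝ, br = (fun f₁ f₂ => ∑' x : ℤ, ((∫ σ, f₁ σ * f₂ (fun i => σ (i + x)) ∂μT) -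 (∫ σ, f₁ σ ∂μT) * (∫ σ, f₂ σ ∂μT))) → ∀ jZ : Literature.MathematicalPhysics.KineticTheory.HeatConduction.ChainConfig → ℝ, jZ = (fun σ => (Literature.MathematicalPhysics.KineticTheory.HeatConduction.pinnedChain ω₂ lam β γ).bondCurrentZ σ 0) → ∀ ν : ℝ, 0 < ν → ∀ g u : Literature.MathematicalPhysics.KineticTheory.HeatConduction.ChainConfig → ℝ, Literature.MathematicalPhysics.KineticTheory.HeatConduction.IsLocalTestFunction g → Literature.MathematicalPhysics.KineticTheory.HeatConduction.IsLocalTestFunction u → (ν⁻¹ * br (jZ + Literature.MathematicalPhysics.KineticTheory.HeatConduction.liouvilleZ (Literature.MathematicalPhysics.KineticTheory.HeatConduction.pinnedChain ω₂ lam β γ) u) (jZ + Literature.MathematicalPhysics.KineticTheory.HeatConduction.liouvilleZ (Literature.MathematicalPhysics.KineticTheory.HeatConduction.pinnedChain ω₂ lam β γ) u) + ν * br u u) - (2 * br jZ g - ν * br g g - ν⁻¹ * br (Literature.MathematicalPhysics.KineticTheory.HeatConduction.liouvilleZ (Literature.MathematicalPhysics.KineticTheory.HeatConduction.pinnedChain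 ω₂ lam β γ) g) (Literature.MathematicalPhysics.KineticTheory.HeatConduction.liouvilleZ (Literature.MathematicalPhysics.KineticTheory.HeatConduction.pinnedChain ω₂ lam β γ) g)) = ν⁻¹ * br (fun σ => jZ σ + Literature.MathematicalPhysics.KineticTheory.HeatConduction.liouvilleZ (Literature.MathematicalPhysics.KineticTheory.HeatConduction.pinnedChain ω₂ lam β γ) u σ - ν * g σ) (fun σ => jZ σ + Literature.MathematicalPhysics.KineticTheory.HeatConduction.liouvilleZ (Literature.MathematicalPhysics.KineticTheory.HeatConduction.pinnedChain ω₂ lam β γ) u σ - ν * g σ) + ν⁻¹ * br (fun σ => ν * u σ - Literature.MathematicalPhysics.KineticTheory.HeatConduction.liouvilleZ (Literature.MathematicalPhysics.KineticTheory.HeatConduction.pinnedChain ω₂ lam β γ) g σ) (fun σ => ν * u σ - Literature.MathematicalPhysics.KineticTheory.HeatConduction.liouvilleZ (Literature.MathematicalPhysics.KineticTheory.HeatConduction.pinnedChain ω₂ lam β γ) g σ)) →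
    (∀ ω₂ lam β γ : ℝ, 0 < ω₂ → 0 < lam → 0 < β → 0 < γ → ∀ T : ℝ, 0 < T → ∀ μT : MeasureTheory.Measure Literature.MathematicalPhysics.KineticTheory.HeatConduction.ChainConfig, (Literature.MathematicalPhysics.KineticTheory.HeatConduction.pinnedChain ω₂ lam β γ).IsChainGibbsMeasure T μT → Literature.MathematicalPhysics.KineticTheory.HeatConduction.IsShiftInvariant μT → ∀ br : (Literature.MathematicalPhysics.KineticTheory.HeatConduction.ChainConfig → ℝ) → (Literature.MathematicalPhysics.KineticTheory.HeatConduction.ChainConfig → ℝ) → ℝ, br = (fun f₁ f₂ => ∑' x : ℤ, ((∫ σ, f₁ σ * f₂ (fun i => σ (i + x)) ∂μT) - (∫ σ, f₁ σ ∂μT) * (∫ σ, f₂ σ ∂μT))) → ∀ jZ : Literature.MathematicalPhysics.KineticTheory.HeatConduction.ChainConfig → ℝ, jZ = (fun σ => (Literature.MathematicalPhysics.KineticTheory.HeatConduction.pinnedChain ω₂ lam β γ).bondCurrentZ σ 0) → ∀ ν : ℝ, 0 < ν → ∀ ε : ℝ, 0 < ε → ∃ g u : Literature.MathematicalPhysics.KineticTheory.HeatConduction.ChainConfig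 → ℝ, Literature.MathematicalPhysics.KineticTheory.HeatConduction.IsLocalTestFunction g ∧ Literature.MathematicalPhysics.KineticTheory.HeatConduction.IsLocalTestFunction u ∧ br (fun σ => jZ σ + Literature.MathematicalPhysics.KineticTheory.HeatConduction.liouvilleZ (Literature.MathematicalPhysics.KineticTheory.HeatConduction.pinnedChain ω₂ lam β γ) u σ - ν * g σ) (fun σ => jZ σ + Literature.MathematicalPhysics.KineticTheory.HeatConduction.liouvilleZ (Literature.MathematicalPhysics.KineticTheory.HeatConduction.pinnedChain ω₂ lam β γ) u σ - ν * g σ) + br (fun σ => ν * u σ - Literature.MathematicalPhysics.KineticTheory.HeatConduction.liouvilleZ (Literature.MathematicalPhysics.KineticTheory.HeatConduction.pinnedChain ω₂ lam β γ) g σ) (fun σ => ν * u σ - Literature.MathematicalPhysics.KineticTheory.HeatConduction.liouvilleZ (Literature.MathematicalPhysics.KineticTheory.HeatConduction.pinnedChain ω₂ lam β γ) g σ) ≤ ε) →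
    (∀ ω₂ lam β γ : ℝ, 0 < ω₂ → 0 < lam → 0 < β → 0 < γ → ∀ T : ℝ, 0 < T → ∀ μT : MeasureTheory.Measure Literature.MathematicalPhysics.KineticTheory.HeatConduction.ChainConfig, (Literature.MathematicalPhysics.KineticTheory.HeatConduction.pinnedChain ω₂ lam β γ).IsChainGibbsMeasure T μT → Literature.MathematicalPhysics.KineticTheory.HeatConduction.IsShiftInvariant μT → let br : (Literature.MathematicalPhysics.KineticTheory.HeatConduction.ChainConfig → ℝ) → (Literature.MathematicalPhysics.KineticTheory.HeatConduction.ChainConfig → ℝ) → ℝ := fun f₁ f₂ => ∑' x : ℤ, ((∫ σ, f₁ σ * f₂ (fun i => σ (i + x)) ∂μT) - (∫ σ, f₁ σ ∂μT) * (∫ σ, f₂ σ ∂μT)); let jZ : Literature.MathematicalPhysics.KineticTheory.HeatConduction.ChainConfig → ℝ := fun σ => (Literature.MathematicalPhysics.KineticTheory.HeatConduction.pinnedChain ω₂ lam β γ).bondCurrentZ σ 0; ∀ ν : ℝ, 0 < ν → ∀ ε : ℝ, 0 < ε → ∃ g u : Literature.MathematicalPhysics.KineticTheory.HeatConduction.ChainConfig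 → ℝ, Literature.MathematicalPhysics.KineticTheory.HeatConduction.IsLocalTestFunction g ∧ Literature.MathematicalPhysics.KineticTheory.HeatConduction.IsLocalTestFunction u ∧ (ν⁻¹ * br (jZ + Literature.MathematicalPhysics.KineticTheory.HeatConduction.liouvilleZ (Literature.MathematicalPhysics.KineticTheory.HeatConduction.pinnedChain ω₂ lam β γ) u) (jZ + Literature.MathematicalPhysics.KineticTheory.HeatConduction.liouvilleZ (Literature.MathematicalPhysics.KineticTheory.HeatConduction.pinnedChain ω₂ lam β γ) u) + ν * br u u) ≤ (2 * br jZ g - ν * br g g - ν⁻¹ * br (Literature.MathematicalPhysics.KineticTheory.HeatConduction.liouvilleZ (Literature.MathematicalPhysics.KineticTheory.HeatConduction.pinnedChain ω₂ lam β γ) g) (Literature.MathematicalPhysics.KineticTheory.HeatConduction.liouvilleZ (Literature.MathematicalPhysics.KineticTheory.HeatConduction.pinnedChain ω₂ lam β γ) g)) + ε) := by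
  intro hI hR ω₂ lam β γ hω hl hβ hγ T hT μT hGibbs hShift br jZ ν hν ε hε
  -- `br`, `jZ` are the crux's `let`-bound bracket and current; the stubs take them as arguments with
  -- their defining equations, discharged here by `rfl` (zeta-delta)
  obtain ⟨g, u, hg, hu, hres⟩ :=
    hR ω₂ lam β γ hω hl hβ hγ T hT μT hGibbs hShift br rfl jZ rfl ν hν (ν * ε) (mul_pos hν hε)
  exact ⟨g, u, hg, hu, gap_le_of_identity_of_residual ν ε _ _ _ _ hν
    (hI ω₂ lam β γ hω hl hβ hγ T hT μT hGibbs hShift br rfl jZ rfl ν hν g u hg hu) hres⟩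

/-- **Skeleton theorem — the crux `StaticAbelianSqueeze.LiouvilleNoGap` BY NAME from the two registered
stubs** (the only theorem of this file concluding the crux; its `sorry`s are exactly those of
`stub_gapIdentity` and `stub_saddleResidual`; the seam is the sorry-free
`liouvilleNoGap_of_gapIdentity_of_saddleResidual`). -/
theorem LiouvilleNoGap_of :
    _root_.Summit.AtomisticToContinuum.FouriersLaw.Theses.StaticAbelianSqueeze.LiouvilleNoGap :=
  liouvilleNoGap_of_gapIdentity_of_saddleResidual stub_gapIdentity stub_saddleResidual

end Birth

end Summit.AtomisticToContinuum.FouriersLaw.Cruxes.LiouvilleNoGap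

end
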